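import Summits.Ventures.CertifiedManyBodySolver.Downfold.EmeryAxialFermiSurfaceShape
import Mathlib.Data.Matrix.Block
import Mathlib.LinearAlgebra.Matrix.Determinant.Basic
import HarnessLib

/-!
# The mirror-symmetric bilayer of the four-orbital `CuO₂` model: the interlayer (axial) channel splits it
# into two single-layer models with shifted axial parameters; each sheet is EXACTLY a `t–t′`
# contour; the conduction-band splitting vanishes identically on the zone diagonal

Venture CertifiedManyBodySolver, cell `pub/hubbard-downfold` (stage S1 = ROUTER; INFLATION-RULES-3to1-B: the
bilayer boxes M257 Hg-1212, M260 Tl-2212, #33 Bi-2212, #18 YBa₂Cu₃O₇ carry a one-band `tperp/t` row and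
per-plane `3BE` companions), seat hubbard-downfold-mod-4 (technique B, band level); namespace
`Summit.Ventures.CertifiedManyBodySolver.Downfold.Emery`. Everything here is PROVED (exact algebra). WHAT
THIS IS NOT: a statement about any material; `ε_s`, `t_sp`, `t⊥_ss`, `t⊥_sp` are model inputs; the interlayer
channel is the axial (Cu-4s / apical) one ONLY — direct interlayer `p–p` / `d–d` hoppings («their effects tend
to cancel», loc. cit.) and the dimpling of real bilayers are not modelled.

The situation. In the cuprate four-orbital picture [AndersenEtAl1995] the two `CuO₂` planes of a
bilayer talk through the axial orbital (Cu 4s hybridised with apical O p_z): the interlayer term couples the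
`s` orbital of one plane to the `s` orbital (amplitude `t⊥_ss`) and to the `p_σ` orbitals (amplitude `t⊥_sp`) of
the other, and nothing else [AndersenEtAl1995, Eq. (7), text before Eq. (24)]. The bilayer
Bloch matrix is then the MIRROR-SYMMETRIC block matrix `fromBlocks H T T H` with `H = fourBandPP …`
(`EmeryAxialFermiSurfaceShape`) and `T = axialInterlayer t⊥_ss t⊥_sp` — and `H ± T` is again a
single-layer `fourBandPP`, with `(ε_s, t_sp) ↦ (ε_s ± t⊥_ss, t_sp ± t⊥_sp)`: «the Hamiltonians `H^P` depend on
the mid-plane parity `P` only through `s^P`» [AndersenEtAl1995, before Eq. (24)].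

* §1 (any commutative ring, any blocks) `det_fromBlocks_mirror`: `det (fromBlocks A B B A) =
  det (A + B) · det (A − B)` — the even/odd (mirror) sectors, by two block row/column operations; and
  `fromBlocks_mirror_sub_smul_one`.
* §2 `axialInterlayer` (the interlayer term) and `fourBandPP_add_axialInterlayer` /
  `fourBandPP_sub_axialInterlayer`: `H ± T` is the SINGLE-layer four-orbital model with
  `(ε_s ± t⊥_ss, t_sp ± t⊥_sp)`. Hence `det_bilayerPP_sub`: the bilayer secular determinant at `(k, ε)` is the
  PRODUCT of the two single-layer ones (even / odd parameters), and
  `det_bilayerPP_eq_zero_iff`: `ε` is a bilayer band energy at `k` iff it is a band energy of one of the two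
  shifted single-layer models.
* §3 THE BILAYER CONTOUR THEOREM `det_bilayerPP_eq_zero_iff_oneBand`: for `ε ≠ ε_s ± t_⊥` every
  constant-energy contour of the bilayer (in particular its two Fermi sheets) is EXACTLY the union of TWO pure
  `t–t′` contours, with `t′/t = fsRatio Δ t_pd (t_pp + a_±) (t_pp′ + a_±) ε`,
  `a_± = (t_sp ± t⊥_sp)²/(ε_s ± t⊥_ss − ε)`
  (`EmeryAxialFermiSurfaceShape.det_fourBandPP_eq_zero_iff_oneBand` per sector): the interlayer channel acts
  on each sheet as an axial CO-SHIFT of the two oxygen–oxygen hoppings, i.e. through the `(t′, t″)` axial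
  signature of `EmeryAxialShift`, not through `t`.
* §4 THE NODAL LINE: on the zone diagonal `sx² = sy² = x` the single-layer determinant FACTORISES,
  `det(H₄ − ε) = −dQuad · ((ε_s − ε)(Δ + 4(t_pp′ + t_pp)x + ε) + 8t_sp²x)` (`det_fourBandPP_sub_diag`), with
  the d-sector quadratic `dQuad = ε(Δ + 4(t_pp′ − t_pp)x + ε) − 8t_pd²x` INDEPENDENT of `ε_s`, `t_sp`
  (`charCubic_diag`, `axialLin_diag`); so a conduction-band energy on the diagonal (`dQuad = 0`) is a band
  energy of BOTH mirror sectors (`det_bilayerPP_diag_of_dQuad`): the bilayer splitting of the `CuO₂` band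
  vanishes identically along Γ–M — the `v²` node of [AndersenEtAl1995, Eq. (24)], exactly.
* §5 ORDERING OF THE TWO SHEETS' `t′/t` for pure `s`–`s` coupling (`fsRatio_oddSector_le_evenSector`): with
  both shifted axial levels above the band energy (`ε < ε_s − t⊥_ss`, `0 ≤ t⊥_ss`) the odd sector (axial level
  `ε_s − t⊥_ss`, nearer the band)
  has the larger admixture `a_− ≥ a_+ ≥ 0` and hence, in the charge-transfer regime of
  `fsRatio_coshift_anti`, the MORE cuprate-like (more negative) `t′/t`.

Sources: [AndersenEtAl1995, Eq. (7) and Eqs. (24)–(25) (interplane hopping via Cu 4s;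
`t_⊥(k) ∝ v² = ((cos kx − cos ky)/2)²`, minimum along ΓM, maximum at X)];
[PavariniEtAl2001, Eqs. (1)–(3)].
-/

noncomputable section

namespace Summit.Ventures.CertifiedManyBodySolver.Downfold.Emery

open Matrix

/-! ## §1 Mirror-symmetric block matrices: even and odd sectors -/

section Mirror

variable {n : Type*} [Fintype n] [DecidableEq n] {R : Type*} [CommRing R]

/-- **Mirror factorisation**: `det (fromBlocks A B B A) = det (A + B) · det (A − B)` (even sector `A + B` on
`x + y`, odd sector `A − B` on `x − y`), over any commutative ring, by the block operations
`row₁ += row₂`, `col₂ −= col₁`. [folklore] -/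
theorem det_fromBlocks_mirror (A B : Matrix n n R) :
    (fromBlocks A B B A).det = (A + B).det * (A - B).det := by
  have h1 : fromBlocks (1 : Matrix n n R) (1 : Matrix n n R) (0 : Matrix n n R) (1 : Matrix n n R) *
      fromBlocks A B B A = fromBlocks (A + B) (A + B) B A := by
    rw [fromBlocks_multiply]
    simp [add_comm]
  have h2 : fromBlocks (A + B) (A + B) B A *
      fromBlocks (1 : Matrix n n R) (-1 : Matrix n n R) (0 : Matrix n n R) (1 : Matrix n n R) =
      fromBlocks (A + B) 0 B (A - B) := by
    rw [fromBlocks_multiply]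
    simp only [Matrix.mul_one, Matrix.mul_zero, Matrix.mul_neg, add_zero, neg_add_cancel, neg_add_eq_sub]
  have hd1 : (fromBlocks (1 : Matrix n n R) (1 : Matrix n n R) (0 : Matrix n n R) (1 : Matrix n n R)).det = 1 := by
    rw [det_fromBlocks_zero₂₁, det_one, mul_one]
  have hd2 : (fromBlocks (1 : Matrix n n R) (-1 : Matrix n n R) (0 : Matrix n n R) (1 : Matrix n n R)).det = 1 := by
    rw [det_fromBlocks_zero₂₁, det_one, mul_one]
  have key := congrArg Matrix.det h2
  rw [← h1, det_mul, det_mul, hd1, hd2, one_mul, mul_one, det_fromBlocks_zero₁₂] at key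
  exact key

omit [Fintype n] in
/-- `fromBlocks A B B A − ε·1 = fromBlocks (A − ε·1) B B (A − ε·1)`. [folklore] -/
theorem fromBlocks_mirror_sub_smul_one (A B : Matrix n n R) (ε : R) :
    fromBlocks A B B A - ε • (1 : Matrix (n ⊕ n) (n ⊕ n) R) =
      fromBlocks (A - ε • (1 : Matrix n n R)) B B (A - ε • (1 : Matrix n n R)) := by
  rw [← fromBlocks_one, fromBlocks_smul, sub_eq_add_neg, fromBlocks_neg, fromBlocks_add]
  simp [sub_eq_add_neg]

/-- Secular determinant of a mirror-symmetric bilayer: `det(fromBlocks A B B A − ε) =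
det(A + B − ε)·det(A − B − ε)`. [folklore] -/
theorem det_fromBlocks_mirror_sub (A B : Matrix n n R) (ε : R) :
    (fromBlocks A B B A - ε • (1 : Matrix (n ⊕ n) (n ⊕ n) R)).det =
      (A + B - ε • (1 : Matrix n n R)).det * (A - B - ε • (1 : Matrix n n R)).det := by
  rw [fromBlocks_mirror_sub_smul_one, det_fromBlocks_mirror]
  congr 2
  · abel
  · abel

end Mirror

/-! ## §2 The axial interlayer terms: the two sectors are single layers with `ε_s ± t⊥_ss`, `t_sp ± t⊥_sp` -/

/-- **The interlayer term of the four-orbital bilayer** [AndersenEtAl1995, Eq. (7) and the text before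
Eq. (24): «neglect all inter-plane hoppings other than `t⊥_ss` and `t⊥_sp`»]: `s`–`s` amplitude `t⊥_ss` and
`s`–`p` amplitudes `2t⊥_sp sx`, `2t⊥_sp sy` between the planes (orbital order `(d, s, pₓ, p_y)` as in
`fourBandPP`); no direct interlayer `p–p` / `d–d` term. [cite: AndersenEtAl1995, Eqs. (7), (24)] -/
def axialInterlayer (tss tspP sx sy : ℝ) : Matrix (Fin 4) (Fin 4) ℝ :=
  !![0, 0, 0, 0; 0, tss, 2 * tspP * sx, 2 * tspP * sy; 0, 2 * tspP * sx, 0, 0; 0, 2 * tspP * sy, 0, 0]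

/-- EVEN sector: `H + T` is the single layer with axial level `ε_s + t⊥_ss` and axial coupling
`t_sp + t⊥_sp` («the Hamiltonians `H^P` depend on the mid-plane parity only through `s^P`»).
[cite: AndersenEtAl1995, Eq. (7)] -/
theorem fourBandPP_add_axialInterlayer (Δ εs tpd tpp c tsp tss tspP sx sy : ℝ) :
    fourBandPP Δ εs tpd tpp c tsp sx sy + axialInterlayer tss tspP sx sy =
      fourBandPP Δ (εs + tss) tpd tpp c (tsp + tspP) sx sy := by
  ext i j
  fin_cases i <;> fin_cases j <;> simp [fourBandPP, axialInterlayer] <;> ring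

/-- ODD sector: `H − T` is the single layer with `ε_s − t⊥_ss`, `t_sp − t⊥_sp`. [cite: AndersenEtAl1995, Eq. (7)] -/
theorem fourBandPP_sub_axialInterlayer (Δ εs tpd tpp c tsp tss tspP sx sy : ℝ) :
    fourBandPP Δ εs tpd tpp c tsp sx sy - axialInterlayer tss tspP sx sy =
      fourBandPP Δ (εs - tss) tpd tpp c (tsp - tspP) sx sy := by
  ext i j
  fin_cases i <;> fin_cases j <;> simp [fourBandPP, axialInterlayer] <;> ring

/-- **The bilayer Bloch matrix** of the four-orbital + O–O model with the axial interlayer terms.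
[cite: AndersenEtAl1995, Eq. (7)] -/
def bilayerPP (Δ εs tpd tpp c tsp tss tspP sx sy : ℝ) : Matrix (Fin 4 ⊕ Fin 4) (Fin 4 ⊕ Fin 4) ℝ :=
  fromBlocks (fourBandPP Δ εs tpd tpp c tsp sx sy) (axialInterlayer tss tspP sx sy)
    (axialInterlayer tss tspP sx sy) (fourBandPP Δ εs tpd tpp c tsp sx sy)

/-- **THE BILAYER SECULAR DETERMINANT IS THE PRODUCT OF TWO SINGLE-LAYER ONES** (even: `ε_s + t⊥_ss`,
`t_sp + t⊥_sp`; odd: `ε_s − t⊥_ss`, `t_sp − t⊥_sp`), at every `k` and every `ε`. [cite: AndersenEtAl1995, Eq. (7)] -/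
theorem det_bilayerPP_sub (Δ εs tpd tpp c tsp tss tspP sx sy ε : ℝ) :
    (bilayerPP Δ εs tpd tpp c tsp tss tspP sx sy - ε • (1 : Matrix (Fin 4 ⊕ Fin 4) (Fin 4 ⊕ Fin 4) ℝ)).det =
      (fourBandPP Δ (εs + tss) tpd tpp c (tsp + tspP) sx sy - ε • (1 : Matrix (Fin 4) (Fin 4) ℝ)).det *
        (fourBandPP Δ (εs - tss) tpd tpp c (tsp - tspP) sx sy - ε • (1 : Matrix (Fin 4) (Fin 4) ℝ)).det := by
  unfold bilayerPP
  rw [det_fromBlocks_mirror_sub, fourBandPP_add_axialInterlayer, fourBandPP_sub_axialInterlayer]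

/-- `ε` is a bilayer band energy at `k` iff it is a band energy of the even OR of the odd single layer.
[cite: AndersenEtAl1995, Eq. (7)] -/
theorem det_bilayerPP_eq_zero_iff (Δ εs tpd tpp c tsp tss tspP sx sy ε : ℝ) :
    (bilayerPP Δ εs tpd tpp c tsp tss tspP sx sy - ε • (1 : Matrix (Fin 4 ⊕ Fin 4) (Fin 4 ⊕ Fin 4) ℝ)).det = 0 ↔
      (fourBandPP Δ (εs + tss) tpd tpp c (tsp + tspP) sx sy - ε • (1 : Matrix (Fin 4) (Fin 4) ℝ)).det = 0 ∨
        (fourBandPP Δ (εs - tss) tpd tpp c (tsp - tspP) sx sy - ε • (1 : Matrix (Fin 4) (Fin 4) ℝ)).det = 0 := by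
  rw [det_bilayerPP_sub, mul_eq_zero]

/-- In closed form: the product of the two four-orbital closed forms of
`EmeryAxialFermiSurfaceShape.det_fourBandPP_sub`. [cite: AndersenEtAl1995, Eqs. (2), (5), (7)] -/
theorem det_bilayerPP_sub_closed (Δ εs tpd tpp c tsp tss tspP sx sy ε : ℝ) :
    (bilayerPP Δ εs tpd tpp c tsp tss tspP sx sy - ε • (1 : Matrix (Fin 4 ⊕ Fin 4) (Fin 4 ⊕ Fin 4) ℝ)).det =
      ((εs + tss - ε) * charCubic Δ tpd tpp c (sx ^ 2) (sy ^ 2) ε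
          + (tsp + tspP) ^ 2 * axialLin Δ tpd tpp c (sx ^ 2) (sy ^ 2) ε) *
        ((εs - tss - ε) * charCubic Δ tpd tpp c (sx ^ 2) (sy ^ 2) ε
          + (tsp - tspP) ^ 2 * axialLin Δ tpd tpp c (sx ^ 2) (sy ^ 2) ε) := by
  rw [det_bilayerPP_sub, det_fourBandPP_sub, det_fourBandPP_sub]
  ring

/-! ## §3 The bilayer contour theorem: two exact `t–t′` sheets, split by an axial co-shift -/

/-- **THE BILAYER CONTOUR THEOREM.** For `ε ≠ ε_s + t⊥_ss` and `ε ≠ ε_s − t⊥_ss`: `ε` is a bilayer band energy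
at `k = (kx, ky)` iff `k` lies on one of TWO pure `t–t′` contours — the even sheet with axial admixture
`a₊ = (t_sp + t⊥_sp)²/(ε_s + t⊥_ss − ε)` and the odd sheet with `a₋ = (t_sp − t⊥_sp)²/(ε_s − t⊥_ss − ε)`, each
with `t = fsT Δ t_pd (t_pp + a) (t_pp′ + a) ε`, `t′ = fsTp t_pd (t_pp + a) (t_pp′ + a) ε`: the interlayer
channel moves each sheet's `t′/t = fsRatio Δ t_pd (t_pp + a_±) (t_pp′ + a_±) ε` through a CO-SHIFT of the two
oxygen–oxygen hoppings and nothing else («the inter-plane hopping is proportional to `v²`»).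
[cite: AndersenEtAl1995, Eqs. (7), (24)]; [cite: PavariniEtAl2001, Eqs. (1)–(3)] -/
theorem det_bilayerPP_eq_zero_iff_oneBand (Δ εs tpd tpp c tsp tss tspP kx ky ε γ : ℝ)
    (hp : ε ≠ εs + tss) (hm : ε ≠ εs - tss) :
    (bilayerPP Δ εs tpd tpp c tsp tss tspP (Real.sin (kx / 2)) (Real.sin (ky / 2))
        - ε • (1 : Matrix (Fin 4 ⊕ Fin 4) (Fin 4 ⊕ Fin 4) ℝ)).det = 0 ↔
      (oneBand γ (fsT Δ tpd (tpp + (tsp + tspP) ^ 2 / (εs + tss - ε)) (c + (tsp + tspP) ^ 2 / (εs + tss - ε)) ε)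
            (fsTp tpd (tpp + (tsp + tspP) ^ 2 / (εs + tss - ε)) (c + (tsp + tspP) ^ 2 / (εs + tss - ε)) ε)
            0 kx ky
          = γ - 4 * fsT Δ tpd (tpp + (tsp + tspP) ^ 2 / (εs + tss - ε))
                (c + (tsp + tspP) ^ 2 / (εs + tss - ε)) ε
              - 4 * fsTp tpd (tpp + (tsp + tspP) ^ 2 / (εs + tss - ε))
                (c + (tsp + tspP) ^ 2 / (εs + tss - ε)) ε + cA Δ ε) ∨
      (oneBand γ (fsT Δ tpd (tpp + (tsp - tspP) ^ 2 / (εs - tss - ε)) (c + (tsp - tspP) ^ 2 / (εs - tss - ε)) ε)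
            (fsTp tpd (tpp + (tsp - tspP) ^ 2 / (εs - tss - ε)) (c + (tsp - tspP) ^ 2 / (εs - tss - ε)) ε)
            0 kx ky
          = γ - 4 * fsT Δ tpd (tpp + (tsp - tspP) ^ 2 / (εs - tss - ε))
                (c + (tsp - tspP) ^ 2 / (εs - tss - ε)) ε
              - 4 * fsTp tpd (tpp + (tsp - tspP) ^ 2 / (εs - tss - ε))
                (c + (tsp - tspP) ^ 2 / (εs - tss - ε)) ε + cA Δ ε) := by
  rw [det_bilayerPP_eq_zero_iff,
    det_fourBandPP_eq_zero_iff_oneBand Δ (εs + tss) tpd tpp c (tsp + tspP) kx ky ε γ hp,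
    det_fourBandPP_eq_zero_iff_oneBand Δ (εs - tss) tpd tpp c (tsp - tspP) kx ky ε γ hm]

/-! ## §4 The nodal line: no conduction-band splitting on the zone diagonal -/

/-- **The d-sector quadratic on the diagonal** `sx² = sy² = x`: `dQuad = ε(Δ + 4(t_pp′ − t_pp)x + ε) − 8t_pd²x`
(the `d`–`(pₓ − p_y)` block; its larger root is the conduction band along Γ–M). It contains neither `ε_s`
nor `t_sp`. [cite: AndersenEtAl1995, Eq. (24)] -/
def dQuad (Δ tpd tpp c x ε : ℝ) : ℝ := ε * (Δ + 4 * (c - tpp) * x + ε) - 8 * tpd ^ 2 * x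

/-- **Diagonal factorisation of the σ cubic**: at `x = y`,
`charCubic = (Δ + 4(t_pp′ + t_pp)x + ε) · dQuad` — the `(pₓ + p_y)` band decouples from the `d`–`(pₓ − p_y)`
pair. [folklore] -/
theorem charCubic_diag (Δ tpd tpp c x ε : ℝ) :
    charCubic Δ tpd tpp c x x ε = (Δ + 4 * (c + tpp) * x + ε) * dQuad Δ tpd tpp c x ε := by
  unfold charCubic dQuad
  ring

/-- The d-sector quadratic is INVARIANT under the axial co-shift `(t_pp, t_pp′) ↦ (t_pp + a, t_pp′ + a)` (it
depends on `t_pp′ − t_pp` only). [folklore] -/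
theorem dQuad_coshift (Δ tpd tpp c a x ε : ℝ) :
    dQuad Δ tpd (tpp + a) (c + a) x ε = dQuad Δ tpd tpp c x ε := by
  unfold dQuad
  ring

/-- On the diagonal the axial coefficient is `8x · dQuad`. [folklore] -/
theorem axialLin_diag (Δ tpd tpp c x ε : ℝ) :
    axialLin Δ tpd tpp c x x ε = 8 * x * dQuad Δ tpd tpp c x ε := by
  unfold axialLin dQuad
  ring

/-- **THE FOUR-ORBITAL DETERMINANT FACTORISES ON THE DIAGONAL** (all `ε`, no `ε ≠ ε_s` needed):
`det(H₄ − ε)|_{sx = sy = s} = −dQuad(s²) · ((ε_s − ε)(Δ + 4(t_pp′ + t_pp)s² + ε) + 8t_sp²s²)` — the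
`d`–`(pₓ − p_y)` pair (no axial character) times the `s`–`(pₓ + p_y)` pair. [cite: AndersenEtAl1995, Eq. (24)] -/
theorem det_fourBandPP_sub_diag (Δ εs tpd tpp c tsp s ε : ℝ) :
    (fourBandPP Δ εs tpd tpp c tsp s s - ε • (1 : Matrix (Fin 4) (Fin 4) ℝ)).det =
      -(dQuad Δ tpd tpp c (s ^ 2) ε *
        ((εs - ε) * (Δ + 4 * (c + tpp) * s ^ 2 + ε) + 8 * tsp ^ 2 * s ^ 2)) := by
  rw [det_fourBandPP_sub, charCubic_diag, axialLin_diag]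
  ring

/-- **NO BILAYER SPLITTING OF THE `CuO₂` BAND ALONG Γ–M.** If `ε` is a d-sector energy on the diagonal
(`dQuad(s²) = 0`), then it is a band energy of BOTH mirror sectors of the bilayer at `k = (k₁, k₁)` — for every
axial level, couplings and interlayer amplitudes: the two conduction-band sheets touch identically on the zone
diagonal (the `v² = ((cos kx − cos ky)/2)²` node). [cite: AndersenEtAl1995, Eq. (24)] -/
theorem det_bilayerPP_diag_of_dQuad (Δ εs tpd tpp c tsp tss tspP s ε : ℝ)
    (h : dQuad Δ tpd tpp c (s ^ 2) ε = 0) :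
    (fourBandPP Δ (εs + tss) tpd tpp c (tsp + tspP) s s - ε • (1 : Matrix (Fin 4) (Fin 4) ℝ)).det = 0 ∧
      (fourBandPP Δ (εs - tss) tpd tpp c (tsp - tspP) s s - ε • (1 : Matrix (Fin 4) (Fin 4) ℝ)).det = 0 := by
  rw [det_fourBandPP_sub_diag, det_fourBandPP_sub_diag, h]
  simp

/-- … hence such an `ε` is a (doubly degenerate) bilayer band energy on the diagonal.
[cite: AndersenEtAl1995, Eq. (24)] -/
theorem det_bilayerPP_diag_eq_zero_of_dQuad (Δ εs tpd tpp c tsp tss tspP s ε : ℝ)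
    (h : dQuad Δ tpd tpp c (s ^ 2) ε = 0) :
    (bilayerPP Δ εs tpd tpp c tsp tss tspP s s
        - ε • (1 : Matrix (Fin 4 ⊕ Fin 4) (Fin 4 ⊕ Fin 4) ℝ)).det = 0 := by
  rw [det_bilayerPP_eq_zero_iff]
  exact Or.inl (det_bilayerPP_diag_of_dQuad Δ εs tpd tpp c tsp tss tspP s ε h).1

/-- Conversely: a diagonal band energy of a sector that is NOT an energy of that sector's `s`–`(pₓ + p_y)`
pair is a d-sector energy (`dQuad = 0`), hence (by `det_bilayerPP_diag_of_dQuad`) shared with the other sector.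
[folklore] -/
theorem dQuad_eq_zero_of_det_diag (Δ εs' tpd tpp c tsp' s ε : ℝ)
    (hε : (εs' - ε) * (Δ + 4 * (c + tpp) * s ^ 2 + ε) + 8 * tsp' ^ 2 * s ^ 2 ≠ 0)
    (h : (fourBandPP Δ εs' tpd tpp c tsp' s s - ε • (1 : Matrix (Fin 4) (Fin 4) ℝ)).det = 0) :
    dQuad Δ tpd tpp c (s ^ 2) ε = 0 := by
  rw [det_fourBandPP_sub_diag, neg_eq_zero, mul_eq_zero] at h
  rcases h with h | h
  · exact h
  · exact absurd h hε

/-! ## §5 Which sheet is more cuprate-like (pure `s`–`s` interlayer coupling) -/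

/-- The two axial admixtures are ordered when `t⊥_sp = 0`: with `ε < ε_s − t⊥_ss` and `0 ≤ t⊥_ss` (both
shifted axial levels above the band energy), `0 ≤ a₊ = t_sp²/(ε_s + t⊥_ss − ε) ≤ a₋ = t_sp²/(ε_s − t⊥_ss − ε)`.
[folklore] -/
theorem bilayer_admixture_le {εs tsp t ε : ℝ} (hε : ε < εs - t) (ht : 0 ≤ t) :
    0 ≤ tsp ^ 2 / (εs + t - ε) ∧ tsp ^ 2 / (εs + t - ε) ≤ tsp ^ 2 / (εs - t - ε) := by
  have hm : 0 < εs - t - ε := by linarith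
  have hp : 0 < εs + t - ε := by linarith
  refine ⟨div_nonneg (sq_nonneg _) hp.le, ?_⟩
  exact div_le_div_of_nonneg_left (sq_nonneg _) hm (by linarith)

/-- **THE ODD SHEET IS THE MORE CUPRATE-LIKE ONE** (pure `s`–`s` coupling). Under the hypotheses of
`EmeryAxialFermiSurfaceShape.fsRatio_coshift_anti` at the larger admixture `a₋` (charge-transfer regime:
`fsN > 0`, `fsN1 ≥ 0`, `fsD1 ≥ 0`, `fsD − a₋·fsD1 > 0`) and `ε < ε_s − t⊥_ss`, `0 ≤ t⊥_ss`:
`(t′/t)_odd = fsRatio(… + a₋) ≤ (t′/t)_even = fsRatio(… + a₊)` — the sheet whose axial level `ε_s − t⊥_ss` lies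
nearer the band is more negative in `t′/t`. [cite: PavariniEtAl2001, Fig. 3]; [cite: AndersenEtAl1995, Eq. (24)] -/
theorem fsRatio_oddSector_le_evenSector {Δ tpd tpp c εs tsp t ε : ℝ} (hε : ε < εs - t) (ht : 0 ≤ t)
    (hn₀ : 0 < fsN tpd tpp c ε) (hn₁ : 0 ≤ fsN1 tpd tpp c ε) (hd₁ : 0 ≤ fsD1 Δ ε)
    (hd₂ : 0 < fsD Δ tpd c ε - tsp ^ 2 / (εs - t - ε) * fsD1 Δ ε) :
    fsRatio Δ tpd (tpp + tsp ^ 2 / (εs - t - ε)) (c + tsp ^ 2 / (εs - t - ε)) ε ≤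
      fsRatio Δ tpd (tpp + tsp ^ 2 / (εs + t - ε)) (c + tsp ^ 2 / (εs + t - ε)) ε := by
  obtain ⟨h0, hle⟩ := bilayer_admixture_le (tsp := tsp) hε ht
  exact fsRatio_coshift_anti h0 hle hn₀ hn₁ hd₁ hd₂

/-! ## §6 The leading-order dictionary (appended 2026-08-27): a `v²`-modulated splitting `∓t_b·v²`,
`v = (cos kx − cos ky)/2`, IS a per-sheet shift of the one-band parameters `(c, t, t′, t″) ↦ (c ∓ t_b/4, t, t′ ∓ t_b/8,
t″ ± t_b/16)` — `t` untouched, `(Δt′, Δt″)` in the axial signature `(δ, −δ/2)`; the two sheets differ by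
`Δt′ = t_b/4`, `Δt″ = −t_b/8` (INFL-bilayer(E): `|Δ(t′/t)| = (t_b/t)/4`, `|Δ(t″/t)| = (t_b/t)/8` between the sheets). -/

/-- `v² = ((cos kx − cos ky)/2)² = ¼ + (cos 2kx + cos 2ky)/8 − (cos kx cos ky)/2`. [cite: AndersenEtAl1995, Eq. (24)] -/
theorem bilayer_vsq_expand (kx ky : ℝ) :
    ((Real.cos kx - Real.cos ky) / 2) ^ 2 =
      1 / 4 + (Real.cos (2 * kx) + Real.cos (2 * ky)) / 8 - Real.cos kx * Real.cos ky / 2 := by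
  have hx := Real.cos_sq kx
  have hy := Real.cos_sq ky
  nlinarith [hx, hy]

/-- **LOWER (odd-in-energy) sheet**: `ε(k) − t_b·v(k)² = oneBand (c − t_b/4) t (t′ − t_b/8) (t″ + t_b/16)` — the
`v²` splitting moves `t′` by `−t_b/8` and `t″` by `+t_b/16` and leaves `t` alone. [cite: AndersenEtAl1995, Eq. (24)] -/
theorem oneBand_sub_vsq (c t t' t'' tb kx ky : ℝ) :
    oneBand c t t' t'' kx ky - tb * ((Real.cos kx - Real.cos ky) / 2) ^ 2 =
      oneBand (c - tb / 4) t (t' - tb / 8) (t'' + tb / 16) kx ky := by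
  rw [bilayer_vsq_expand]
  unfold oneBand
  ring

/-- **UPPER sheet**: `ε(k) + t_b·v(k)² = oneBand (c + t_b/4) t (t′ + t_b/8) (t″ − t_b/16)`. [cite: AndersenEtAl1995, Eq. (24)] -/
theorem oneBand_add_vsq (c t t' t'' tb kx ky : ℝ) :
    oneBand c t t' t'' kx ky + tb * ((Real.cos kx - Real.cos ky) / 2) ^ 2 =
      oneBand (c + tb / 4) t (t' + tb / 8) (t'' - tb / 16) kx ky := by
  rw [bilayer_vsq_expand]
  unfold oneBand
  ring

/-- **The per-sheet shifts carry the axial signature `(δ, −δ/2)`** (`EmeryAxialShift`): `Δt″ = −Δt′/2` on each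
sheet, and BETWEEN the sheets `Δt′ = t_b/4`, `Δt″ = −t_b/8`, `Δt = 0`. [folklore] -/
theorem bilayer_sheet_shifts (t' t'' tb : ℝ) :
    (t'' - tb / 16) - t'' = -(((t' + tb / 8) - t') / 2) ∧
      (t' + tb / 8) - (t' - tb / 8) = tb / 4 ∧ (t'' - tb / 16) - (t'' + tb / 16) = -(tb / 8) := by
  refine ⟨by ring, by ring, by ring⟩

/-- **The splitting vanishes on the diagonal at leading order too**: `v(k, k) = 0`, so both sheets equal `ε(k, k)`
there (the exact all-order statement is `det_bilayerPP_diag_of_dQuad`). [cite: AndersenEtAl1995, Eq. (24)] -/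
theorem oneBand_vsq_diag (c t t' t'' tb k : ℝ) :
    oneBand c t t' t'' k k - tb * ((Real.cos k - Real.cos k) / 2) ^ 2 = oneBand c t t' t'' k k := by
  simp

/-- **At X = (π, 0) the splitting is maximal, `v² = 1`**: the two sheets differ there by exactly `2t_b`.
[cite: AndersenEtAl1995, Eq. (25)] -/
theorem bilayer_vsq_X : ((Real.cos Real.pi - Real.cos 0) / 2) ^ 2 = 1 := by
  rw [Real.cos_pi, Real.cos_zero]
  norm_num

end Summit.Ventures.CertifiedManyBodySolver.Downfold.Emery

end
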